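import Summits.AtomisticToContinuum.HydrodynamicLimit.Theorems.CollisionIsometryCLTDiffuseBackwardInfluenceTubeLD
import Summits.AtomisticToContinuum.HydrodynamicLimit.Theorems.CollisionIsometryCLTDiffuseBackwardInfluenceContainersOn
import Summits.AtomisticToContinuum.HydrodynamicLimit.Theorems.CollisionIsometryCLTDiffuseBackwardInfluenceContainersAsymptotics
import Literature.Analysis.FluidPDE.HardSphereRegularGeometry
import HarnessLib

/-!
# `stub_stickLD` reduced to ONE geometric inequality: the crossing-energy (supersaturation) bound for random sticks
(crux `DiffuseBackwardInfluence`, stmt-AtomisticToContinuum-12950, line `share-nondegeneracy-one-flight`; lead prover,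
continuation c1; support file of the registered sub-goal `stickLD_of_supersat`)

`FewIdle.StickLD σ θ` (the product-measure random-segment large deviation, `…TubeLD.lean`) is proved here from the named
geometric conjecture `FewIdle.StickSupersat σ θ` by the CONTAINER method:

1. `FewIdle.oneStickLaw θ` — the one-stick law (uniform position on `𝕋³` × Maxwellian velocity), a probability measure,
   and the PRODUCT STRUCTURE `stickLaw θ N = (oneStickLaw θ)^{⊗(N+1)}` (`withDensity_tensorPow_eq_pi`: `pi_withDensity_eq`,
   `prod_withDensity_right`).
2. `FewIdle.Cross ε τ z z'` — two sticks cross within time `τ` at thickness `ε`; its graph is OPEN (`isOpen_setOf_cross`,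
   continuity of the torus translation / minimal-image norm, `Torus.isHardSphereRegular_geometry`) hence measurable, and
   `tubeSet σ N A τ = {Z | ∀ i, j ∈ A, i ≠ j → ¬ Cross ε_N τ (Z i) (Z j)}` (`tubeSet_eq_setOf_not_cross`).
3. `FewIdle.StickSupersat σ θ` (`@[conjecture]`) — the crossing-energy inequality
   `∫_S μ₁(shadow_τ(z) ∩ S) dμ₁ ≥ c₁ ε_N² τ ρ^{4/3} μ₁(S)` for measurable `S` with `μ₁(S) ≥ ρ` (`τ, ρ ∈ (0,1]`).
4. `stickLD_of_supersat` (REGISTERED) — schedules `n_N = min(τ_N,1)(N+1)^{1/3} → ∞`, `ρ_N = max(n_N,1)^{-1/2}`,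
   `d_N = c₁ ε_N² min(τ_N,1) ρ_N^{4/3}/2`, `f_N = ⌈1/d_N⌉₊`; the container bound on the index set `A`
   (`Containers.pi_setOf_pairwise_not_adj_on_le`) gives `stickLaw(tubeSet) ≤ ∑_{t ≤ f_N} (|A| choose t) ρ_N^{|A|-t}`, the
   binomial entropy bound (`Containers.sum_choose_mul_pow_le`) and `f_N/(N+1) = O(n_N^{-1/3}) → 0`,
   `log(1/ρ_N) = ½ log max(n_N,1) → ∞` (`Containers.eventually_container_bound_le`) give `≤ e^{-c(N+1)}` eventually,
   uniformly in `|A| ≥ η(N+1)`.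

So the tube input of the crux is now: crux ⇐ … ⇐ `FewIdle.TubeLD` ⇐ `FewIdle.StickLD` ⇐ `FewIdle.StickSupersat`, the last
a deterministic inequality about measurable subsets of `𝕋³ × ℝ³` with no probability and no dynamics left in it.
-/

namespace Summit.AtomisticToContinuum.HydrodynamicLimit.Theorems.DiffuseBackwardInfluenceShare

open scoped BigOperators Topology ENNReal Classical
open Filter Set MeasureTheory
open Literature.Analysis.FluidPDE
open Literature.MathematicalPhysics.KineticTheory (localGibbsProfile hsDiameter hsDiameter_pos
  withDensity_localMaxwellian_eq_gaussMeasure gaussMeasure pi_withDensity_eq continuous_localMaxwellian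
  localMaxwellian_nonneg)
open Summit.AtomisticToContinuum.HydrodynamicLimit.Theorems.DiffuseBackwardInfluenceNeg

noncomputable section

namespace FewIdle


/-- The ONE-STICK LAW at temperature `θ`: uniform position on `𝕋³` times Maxwellian velocity. -/
def oneStickLaw (θ : ℝ) : Measure (T3 × V3) :=
  (volume : Measure T3).prod
    ((volume : Measure V3).withDensity fun v => ENNReal.ofReal (localMaxwellian 1 θ (0 : V3) v))

/-- The Haar measure of the unit 3-torus is a probability measure. [folklore] -/
theorem isProbabilityMeasure_volume_T3 : IsProbabilityMeasure (volume : Measure T3) := by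
  change IsProbabilityMeasure (volume : Measure (UnitAddTorus (Fin 3)))
  rw [volume_pi]; infer_instance

/-- The one-stick law is a probability measure (`θ > 0`). [folklore] -/
theorem isProbabilityMeasure_oneStickLaw {θ : ℝ} (hθ : 0 < θ) : IsProbabilityMeasure (oneStickLaw θ) := by
  haveI := isProbabilityMeasure_volume_T3
  haveI : IsProbabilityMeasure ((volume : Measure V3).withDensity
      fun v => ENNReal.ofReal (localMaxwellian 1 θ (0 : V3) v)) := by
    rw [withDensity_localMaxwellian_eq_gaussMeasure hθ (0 : V3)]
    infer_instance
  unfold oneStickLaw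
  infer_instance

/-- The homogeneous one-particle profile factorises: `f₀(x, v) = 1 · M_{1,0,θ}(v)`. [folklore] -/
theorem localGibbsProfile_const_apply (θ : ℝ) (y : T3 × V3) :
    localGibbsProfile (fun _ => (1 : ℝ)) (fun _ => (0 : V3)) (fun _ => θ) y = localMaxwellian 1 θ (0 : V3) y.2 := by
  simp [localGibbsProfile]

/-- The one-stick law is Lebesgue measure on `𝕋³ × ℝ³` with density the homogeneous profile. [folklore] -/
theorem oneStickLaw_eq_withDensity (θ : ℝ) :
    oneStickLaw θ = (volume : Measure (T3 × V3)).withDensity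
      fun y => ENNReal.ofReal (localGibbsProfile (fun _ => (1 : ℝ)) (fun _ => (0 : V3)) (fun _ => θ) y) := by
  unfold oneStickLaw
  rw [prod_withDensity_right (by
    exact (continuous_localMaxwellian 1 θ (0 : V3)).measurable.ennreal_ofReal)]
  simp_rw [localGibbsProfile_const_apply]
  rfl

/-- **Product structure**: Lebesgue measure on phase space with density the tensor power of the homogeneous profile
is the product of `N + 1` one-stick laws. [folklore] -/
theorem withDensity_tensorPow_eq_pi (θ : ℝ) (hθ : 0 < θ) (N : ℕ) :
    (volume : Measure (Cfg N)).withDensity (fun z => ENNReal.ofReal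
        (tensorPow (N + 1) (localGibbsProfile (fun _ => (1 : ℝ)) (fun _ => (0 : V3)) (fun _ => θ)) z)) =
      Measure.pi fun _ : Fin (N + 1) => oneStickLaw θ := by
  have hf0 : ∀ y, 0 ≤ localGibbsProfile (fun _ => (1 : ℝ)) (fun _ => (0 : V3)) (fun _ => θ) y := fun y => by
    rw [localGibbsProfile_const_apply]
    exact localMaxwellian_nonneg zero_le_one hθ.le _ _
  have hmeas : Measurable fun y : T3 × V3 =>
      ENNReal.ofReal (localGibbsProfile (fun _ => (1 : ℝ)) (fun _ => (0 : V3)) (fun _ => θ) y) := by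
    simp_rw [localGibbsProfile_const_apply]
    exact ((continuous_localMaxwellian 1 θ (0 : V3)).measurable.comp measurable_snd).ennreal_ofReal
  haveI := isProbabilityMeasure_oneStickLaw hθ
  haveI : SigmaFinite (volume : Measure (T3 × V3)) := by
    change SigmaFinite ((volume : Measure T3).prod (volume : Measure V3)); infer_instance
  simp_rw [oneStickLaw_eq_withDensity]
  rw [pi_withDensity_eq (fun _ : Fin (N + 1) => (volume : Measure (T3 × V3))) (fun _ => hmeas) (fun _ => by
    rw [← oneStickLaw_eq_withDensity]; infer_instance)]
  rw [volume_pi]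
  congr 1
  funext z
  unfold tensorPow
  exact ENNReal.ofReal_prod_of_nonneg fun i _ => hf0 (z i)

/-! ## The crossing relation of two sticks -/

/-- The minimal-image distance between the straight positions of two sticks at time `r`. -/
def crossDist (q : ((T3 × V3) × (T3 × V3)) × ℝ) : ℝ :=
  ‖(Torus.geometry (Fin 3)).sepVec ((Torus.geometry (Fin 3)).translate q.1.1.1 (q.2 • q.1.1.2))
    ((Torus.geometry (Fin 3)).translate q.1.2.1 (q.2 • q.1.2.2))‖

/-- Two sticks `z = (x, v)`, `z' = (x', v')` of `𝕋³` CROSS within time `τ` at thickness `ε`: at some time `r ∈ [0, τ]`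
their straight positions are at minimal-image distance `< ε`. -/
def Cross (ε τ : ℝ) (z z' : T3 × V3) : Prop :=
  ∃ r ∈ Set.Icc (0 : ℝ) τ, crossDist ((z, z'), r) < ε

/-- `crossDist` in coordinates: `‖reprSym ((x + proj (r v)) - (x' + proj (r v')))‖`. [folklore] -/
theorem crossDist_eq (q : ((T3 × V3) × (T3 × V3)) × ℝ) :
    crossDist q = ‖Torus.reprSym ((q.1.1.1 + Literature.Analysis.FunctionSpaces.Torus.proj (q.2 • q.1.1.2)) -
      (q.1.2.1 + Literature.Analysis.FunctionSpaces.Torus.proj (q.2 • q.1.2.2)))‖ := by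
  simp only [crossDist, Torus.geometry_translate, Torus.geometry_sepVec]

/-- `crossDist` is continuous. [folklore] -/
theorem continuous_crossDist : Continuous crossDist := by
  have hp : Continuous (Literature.Analysis.FunctionSpaces.Torus.proj : V3 → T3) :=
    Literature.Analysis.FunctionSpaces.Torus.continuous_proj
  have hkey : Continuous fun q : ((T3 × V3) × (T3 × V3)) × ℝ =>
      (q.1.1.1 + Literature.Analysis.FunctionSpaces.Torus.proj (q.2 • q.1.1.2)) -
        (q.1.2.1 + Literature.Analysis.FunctionSpaces.Torus.proj (q.2 • q.1.2.2)) := by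
    fun_prop
  have h := (Torus.continuous_norm_reprSym (d := Fin 3)).comp hkey
  refine (continuous_congr crossDist_eq).2 ?_
  exact h

/-- The graph of the crossing relation is OPEN (a union over `r ∈ [0, τ]` of open sets). [folklore] -/
theorem isOpen_setOf_cross (ε τ : ℝ) : IsOpen {p : (T3 × V3) × (T3 × V3) | Cross ε τ p.1 p.2} := by
  have : {p : (T3 × V3) × (T3 × V3) | Cross ε τ p.1 p.2} =
      ⋃ r ∈ Set.Icc (0 : ℝ) τ, {p : (T3 × V3) × (T3 × V3) | crossDist (p, r) < ε} := by
    ext p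
    simp only [Cross, mem_setOf_eq, mem_iUnion, exists_prop]
  rw [this]
  refine isOpen_biUnion fun r _ => ?_
  exact isOpen_lt (continuous_crossDist.comp (continuous_id.prodMk continuous_const)) continuous_const

/-- The graph of the crossing relation is measurable. [folklore] -/
theorem measurableSet_setOf_cross (ε τ : ℝ) : MeasurableSet {p : (T3 × V3) × (T3 × V3) | Cross ε τ p.1 p.2} :=
  (isOpen_setOf_cross ε τ).measurableSet

/-- The static tube event of an index set is the non-crossing event of its sticks. [folklore] -/
theorem tubeSet_eq_setOf_not_cross (σ : ℝ) (N : ℕ) (A : Finset (Fin (N + 1))) (τ : ℝ) :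
    tubeSet σ N A τ = {z : Cfg N | ∀ i ∈ A, ∀ j ∈ A, i ≠ j → ¬ Cross (hsDiameter σ N) τ (z i) (z j)} := by
  ext z
  simp only [tubeSet, Cross, crossDist, mem_setOf_eq, freeFlight_apply, not_exists, not_and, not_lt]


/-! ## The geometric supersaturation conjecture and the reduction `StickSupersat ⇒ StickLD` -/

/-- **THE CROSSING-ENERGY (SUPERSATURATION) INEQUALITY FOR RANDOM STICKS** — an OPEN named conjecture of this
programme (obligation node; the geometric half of the container proof of `StickLD`). At reduced density `σ` and
temperature `θ` there is `c₁ > 0` such that for every particle number `N + 1` (thickness `ε_N = σ(N+1)^{-1/3}`), every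
duration `τ ∈ (0, 1]`, every level `ρ ∈ (0, 1]` and every measurable set `S` of sticks with `μ₁(S) ≥ ρ`
(`μ₁ = oneStickLaw θ` = uniform position × Maxwellian velocity), the mean number of `S`-sticks crossed by an `S`-stick
is at least `c₁ ε_N² τ ρ^{4/3}`:  `∫_S μ₁({z' | Cross ε_N τ z z'} ∩ S) dμ₁(z) ≥ c₁ ε_N² τ ρ^{4/3} μ₁(S)`.
Heuristics: the near-extremisers are velocity-coherent tubes `{|v − u| ≤ w}` and their Lipschitz-field versions
`{|v − u(x)| ≤ w}` (measure `≍ (w/√θ)³`, internal crossing rate `≍ π ε² τ w`, whence the exponent `4/3 = 1 + 1/3`);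
sets with fat velocity fibres have spread `≳ μ₁(S)^{1/3} √θ` and cross at least at that rate; interleaved dusts of
different velocities cross at the unconditional rate `≍ ε² τ √θ`. No proof in the tree or in print. -/
@[conjecture] def StickSupersat (σ θ : ℝ) : Prop :=
  ∃ c₁ : ℝ, 0 < c₁ ∧ ∀ (N : ℕ) (τ ρ : ℝ), 0 < τ → τ ≤ 1 → 0 < ρ → ρ ≤ 1 →
    ∀ S : Set (T3 × V3), MeasurableSet S → ENNReal.ofReal ρ ≤ oneStickLaw θ S →
      ENNReal.ofReal (c₁ * hsDiameter σ N ^ 2 * τ * ρ ^ (4 / 3 : ℝ)) * oneStickLaw θ S ≤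
        ∫⁻ z in S, oneStickLaw θ ({z' | Cross (hsDiameter σ N) τ z z'} ∩ S) ∂(oneStickLaw θ)

/-- The tube event is ANTITONE in the duration: longer tubes cross more. [folklore] -/
theorem tubeSet_mono {σ : ℝ} {N : ℕ} (A : Finset (Fin (N + 1))) {τ₁ τ₂ : ℝ} (h : τ₂ ≤ τ₁) :
    tubeSet σ N A τ₁ ⊆ tubeSet σ N A τ₂ :=
  fun _ hz i hi j hj hij r hr => hz i hi j hj hij r ⟨hr.1, hr.2.trans h⟩

/-- Fixed reduced density, squared: `(N+1) ε_N² = σ² (N+1)^{1/3}`. [folklore] -/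
theorem succ_mul_hsDiameter_sq (σ : ℝ) (N : ℕ) :
    ((N + 1 : ℕ) : ℝ) * hsDiameter σ N ^ 2 = σ ^ 2 * ((N + 1 : ℕ) : ℝ) ^ ((1 : ℝ) / 3) := by
  have hN : (0 : ℝ) < ((N + 1 : ℕ) : ℝ) := by positivity
  have h2 : (((N + 1 : ℕ) : ℝ) ^ (-(1 / 3 : ℝ))) ^ 2 = ((N + 1 : ℕ) : ℝ) ^ (-(2 / 3 : ℝ)) := by
    rw [← Real.rpow_natCast, ← Real.rpow_mul hN.le]; norm_num
  have h3 : ((N + 1 : ℕ) : ℝ) * ((N + 1 : ℕ) : ℝ) ^ (-(2 / 3 : ℝ)) = ((N + 1 : ℕ) : ℝ) ^ ((1 : ℝ) / 3) := by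
    rw [mul_comm, ← Real.rpow_add_one hN.ne']; norm_num
  rw [hsDiameter, mul_pow, h2, ← h3]
  ring

/-- The binomial container sum, from `ℝ≥0∞` to `ℝ`. [folklore] -/
theorem sum_choose_ennreal_eq (k f : ℕ) {ρ : ℝ} (hρ : 0 ≤ ρ) :
    (∑ t ∈ Finset.range (f + 1), ((k.choose t : ℕ) : ℝ≥0∞) * ENNReal.ofReal ρ ^ (k - t)) =
      ENNReal.ofReal (∑ t ∈ Finset.range (f + 1), (k.choose t : ℝ) * ρ ^ (k - t)) := by
  rw [ENNReal.ofReal_sum_of_nonneg fun t _ => by positivity]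
  refine Finset.sum_congr rfl fun t _ => ?_
  rw [ENNReal.ofReal_mul (Nat.cast_nonneg _), ENNReal.ofReal_natCast, ENNReal.ofReal_pow hρ]

/-- `min (τ_N) 1 · (N+1)^{1/3} → ∞` when `τ_N (N+1)^{1/3} → ∞`. [folklore] -/
theorem tendsto_min_one_mul {τ : ℕ → ℝ}
    (hτg : Tendsto (fun N : ℕ => τ N * ((N + 1 : ℕ) : ℝ) ^ ((1 : ℝ) / 3)) atTop atTop) :
    Tendsto (fun N : ℕ => min (τ N) 1 * ((N + 1 : ℕ) : ℝ) ^ ((1 : ℝ) / 3)) atTop atTop := by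
  have hcube : Tendsto (fun N : ℕ => ((N + 1 : ℕ) : ℝ) ^ ((1 : ℝ) / 3)) atTop atTop := by
    have h1 : Tendsto (fun N : ℕ => ((N + 1 : ℕ) : ℝ)) atTop atTop := by
      exact tendsto_natCast_atTop_atTop.comp (tendsto_add_atTop_nat 1)
    exact (tendsto_rpow_atTop (by norm_num : (0 : ℝ) < 1 / 3)).comp h1
  refine tendsto_atTop.2 fun b => ?_
  filter_upwards [tendsto_atTop.1 hτg b, tendsto_atTop.1 hcube b] with N h1 h2
  have hpos : 0 ≤ ((N + 1 : ℕ) : ℝ) ^ ((1 : ℝ) / 3) := Real.rpow_nonneg (by positivity) _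
  rcases le_total (τ N) 1 with h | h
  · rw [min_eq_left h]; exact h1
  · rw [min_eq_right h, one_mul]; exact h2

/-- **REGISTERED SUB-GOAL — the stick large deviation from the crossing-energy inequality** (containers): for
`0 < σ` and `0 < θ`, `FewIdle.StickSupersat σ θ → FewIdle.StickLD σ θ`. Given `τ_N` with `n_N := min(τ_N,1)(N+1)^{1/3} → ∞`
put `m_N := max(n_N, 1)`, `ρ_N := m_N^{-1/2}`, `d_N := c₁ ε_N² min(τ_N,1) ρ_N^{4/3} / 2`, `f_N := ⌈1/d_N⌉₊`: the container bound
(`Containers.pi_setOf_pairwise_not_adj_on_le` for `μ₁^{⊗(N+1)}` and the crossing relation, supersaturation at `(ρ_N, 2d_N)`)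
gives `stickLaw(tubeSet) ≤ ∑_{t ≤ f_N} (|A| choose t) ρ_N^{|A|-t} ≤ e^{f_N}(|A|/f_N)^{f_N} ρ_N^{|A|-f_N}`, and since
`f_N/(N+1) = O(n_N^{-1/3}) → 0` while `log(1/ρ_N) = ½ log m_N → ∞`, this is `≤ e^{-c(N+1)}` eventually, uniformly in
`|A| ≥ η(N+1)` (`Containers.eventually_container_bound_le`). [folklore] -/
theorem stickLD_of_supersat : ∀ σ θ : ℝ, 0 < σ → 0 < θ → FewIdle.StickSupersat σ θ → FewIdle.StickLD σ θ := by
  intro σ θ hσ hθ hS τ hτ hτg η hη c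
  obtain ⟨c₁, hc₁, hsat⟩ := hS
  haveI hP : IsProbabilityMeasure (oneStickLaw θ) := isProbabilityMeasure_oneStickLaw hθ
  -- schedules
  set τ' : ℕ → ℝ := fun N => min (τ N) 1 with hτ'
  have hτ'pos : ∀ N, 0 < τ' N := fun N => lt_min (hτ N) one_pos
  have hτ'le1 : ∀ N, τ' N ≤ 1 := fun N => min_le_right _ _
  have hτ'le : ∀ N, τ' N ≤ τ N := fun N => min_le_left _ _
  set n : ℕ → ℝ := fun N => τ' N * ((N + 1 : ℕ) : ℝ) ^ ((1 : ℝ) / 3) with hn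
  have hn_tend : Tendsto n atTop atTop := tendsto_min_one_mul hτg
  set m : ℕ → ℝ := fun N => max (n N) 1 with hm
  have hm1 : ∀ N, 1 ≤ m N := fun N => le_max_right _ _
  have hmpos : ∀ N, 0 < m N := fun N => one_pos.trans_le (hm1 N)
  have hm_tend : Tendsto m atTop atTop :=
    tendsto_atTop_mono (fun N => le_max_left _ _) hn_tend
  set ρ : ℕ → ℝ := fun N => m N ^ (-(1 / 2 : ℝ)) with hρ
  have hρpos : ∀ N, 0 < ρ N := fun N => Real.rpow_pos_of_pos (hmpos N) _
  have hρle1 : ∀ N, ρ N ≤ 1 := fun N =>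
    Real.rpow_le_one_of_one_le_of_nonpos (hm1 N) (by norm_num)
  have hρ43 : ∀ N, ρ N ^ (4 / 3 : ℝ) = m N ^ (-(2 / 3 : ℝ)) := fun N => by
    rw [hρ, ← Real.rpow_mul (hmpos N).le]; norm_num
  set ε : ℕ → ℝ := fun N => hsDiameter σ N with hε
  have hεpos : ∀ N, 0 < ε N := fun N => hsDiameter_pos hσ N
  set d : ℕ → ℝ := fun N => c₁ * ε N ^ 2 * τ' N * ρ N ^ (4 / 3 : ℝ) / 2 with hd
  have hdpos : ∀ N, 0 < d N := fun N => by
    have := hεpos N; have := hτ'pos N; have := Real.rpow_pos_of_pos (hρpos N) (4 / 3 : ℝ)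
    positivity
  set f : ℕ → ℕ := fun N => ⌈1 / d N⌉₊ with hf
  have hf1 : ∀ N, 1 ≤ f N := fun N => Nat.one_le_ceil_iff.2 (one_div_pos.2 (hdpos N))
  -- the key identity: 1/(d_N (N+1)) = 2 m_N^{2/3} / (c₁ σ² n_N)
  have hN1 : ∀ N : ℕ, (0 : ℝ) < ((N + 1 : ℕ) : ℝ) := fun N => by positivity
  have hnpos : ∀ N, 0 < n N := fun N => mul_pos (hτ'pos N) (Real.rpow_pos_of_pos (hN1 N) _)
  have hdN : ∀ N, d N * ((N + 1 : ℕ) : ℝ) = c₁ * σ ^ 2 / 2 * (n N * m N ^ (-(2 / 3 : ℝ))) := by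
    intro N
    have h1 := succ_mul_hsDiameter_sq σ N
    calc d N * ((N + 1 : ℕ) : ℝ)
        = c₁ / 2 * (((N + 1 : ℕ) : ℝ) * hsDiameter σ N ^ 2) * τ' N * ρ N ^ (4 / 3 : ℝ) := by
          rw [hd, hε]; ring
      _ = c₁ * σ ^ 2 / 2 * (n N * m N ^ (-(2 / 3 : ℝ))) := by
          rw [h1, hρ43, hn]; ring
  -- f_N / (N+1) → 0
  have hf0 : Tendsto (fun N => (f N : ℝ) / ((N + 1 : ℕ) : ℝ)) atTop (𝓝 0) := by
    -- eventually m = n, and n · m^{-2/3} = n^{1/3} → ∞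
    have hkey : Tendsto (fun N => n N * m N ^ (-(2 / 3 : ℝ))) atTop atTop := by
      have h13 : Tendsto (fun N => n N ^ ((1 : ℝ) / 3)) atTop atTop :=
        (tendsto_rpow_atTop (by norm_num : (0 : ℝ) < 1 / 3)).comp hn_tend
      refine (tendsto_atTop_mono' atTop ?_ h13)
      filter_upwards [hn_tend.eventually_ge_atTop 1] with N hN
      have hmn : m N = n N := max_eq_left hN
      rw [hmn]
      have : n N * n N ^ (-(2 / 3 : ℝ)) = n N ^ ((1 : ℝ) / 3) := by
        conv_lhs => rw [show n N = n N ^ (1 : ℝ) from (Real.rpow_one _).symm]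
        rw [← Real.rpow_mul (hnpos N).le, ← Real.rpow_add (hnpos N)]
        norm_num
      rw [this]
    have hinv : Tendsto (fun N => (1 / d N + 1) / ((N + 1 : ℕ) : ℝ)) atTop (𝓝 0) := by
      have h1 : Tendsto (fun N => 1 / (d N * ((N + 1 : ℕ) : ℝ))) atTop (𝓝 0) := by
        have h2 : Tendsto (fun N => d N * ((N + 1 : ℕ) : ℝ)) atTop atTop := by
          simp_rw [hdN]
          exact hkey.const_mul_atTop (by positivity)
        exact h2.inv_tendsto_atTop.congr fun N => (one_div _).symm
      have h3 : Tendsto (fun N : ℕ => 1 / ((N + 1 : ℕ) : ℝ)) atTop (𝓝 0) := by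
        have := tendsto_one_div_add_atTop_nhds_zero_nat (𝕜 := ℝ)
        refine this.congr fun N => ?_
        push_cast; rfl
      have h4 := h1.add h3
      rw [add_zero] at h4
      refine h4.congr fun N => ?_
      rw [add_div, div_div]
    refine squeeze_zero (fun N => by positivity) (fun N => ?_) hinv
    refine div_le_div_of_nonneg_right ?_ (hN1 N).le
    exact (Nat.ceil_lt_add_one (one_div_pos.2 (hdpos N)).le).le
  have hρev : ∀ᶠ N in atTop, 0 < ρ N ∧ ρ N ≤ 1 := Eventually.of_forall fun N => ⟨hρpos N, hρle1 N⟩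
  have hlog : Tendsto (fun N => Real.log (1 / ρ N)) atTop atTop := by
    have h1 : ∀ N, Real.log (1 / ρ N) = (1 / 2) * Real.log (m N) := fun N => by
      rw [hρ, one_div, ← Real.rpow_neg (hmpos N).le, neg_neg, Real.log_rpow (hmpos N)]
    simp_rw [h1]
    exact (Real.tendsto_log_atTop.comp hm_tend).const_mul_atTop (by norm_num)
  have hbound := Containers.eventually_container_bound_le hη (Eventually.of_forall hf1) hf0 hρev hlog c
  have hfsmall : ∀ᶠ N in atTop, (f N : ℝ) / ((N + 1 : ℕ) : ℝ) ≤ η / 2 :=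
    hf0.eventually (ge_mem_nhds (by positivity))
  filter_upwards [hbound, hfsmall] with N hbN hfN A hA
  -- sizes
  set k : ℕ := A.card with hk
  have hkN : k ≤ N + 1 := (Finset.card_le_univ A).trans_eq (by simp)
  have hfk : f N ≤ k := by
    have h1 : (f N : ℝ) ≤ η / 2 * ((N + 1 : ℕ) : ℝ) := by
      rwa [div_le_iff₀ (hN1 N)] at hfN
    have h2 : (f N : ℝ) ≤ k := by
      have : η / 2 * ((N + 1 : ℕ) : ℝ) ≤ η * ((N + 1 : ℕ) : ℝ) := by nlinarith [hN1 N]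
      exact h1.trans (this.trans hA)
    exact_mod_cast h2
  -- the container bound for the product of one-stick laws
  have hAdj := measurableSet_setOf_cross (ε N) (τ' N)
  have hd_enn : (0 : ℝ≥0∞) < ENNReal.ofReal (d N) := ENNReal.ofReal_pos.2 (hdpos N)
  have hρ_enn : (0 : ℝ≥0∞) < ENNReal.ofReal (ρ N) := ENNReal.ofReal_pos.2 (hρpos N)
  have hsatN : ∀ S : Set (T3 × V3), MeasurableSet S → ENNReal.ofReal (ρ N) ≤ oneStickLaw θ S →
      2 * ENNReal.ofReal (d N) * oneStickLaw θ S ≤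
        ∫⁻ z in S, oneStickLaw θ ({z' | Cross (ε N) (τ' N) z z'} ∩ S) ∂(oneStickLaw θ) := by
    intro S hSm hSρ
    have h2d : 2 * ENNReal.ofReal (d N) = ENNReal.ofReal (c₁ * hsDiameter σ N ^ 2 * τ' N * ρ N ^ (4 / 3 : ℝ)) := by
      rw [← ENNReal.ofReal_ofNat 2, ← ENNReal.ofReal_mul (by norm_num)]
      congr 1
      rw [hd, hε]; ring
    rw [h2d]
    exact hsat N (τ' N) (ρ N) (hτ'pos N) (hτ'le1 N) (hρpos N) (hρle1 N) S hSm hSρ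
  have hfinv : (ENNReal.ofReal (d N))⁻¹ ≤ (f N : ℝ≥0∞) := by
    rw [← ENNReal.ofReal_inv_of_pos (hdpos N), ← ENNReal.ofReal_natCast]
    refine ENNReal.ofReal_le_ofReal ?_
    rw [inv_eq_one_div]
    exact Nat.le_ceil _
  have hcont := Containers.pi_setOf_pairwise_not_adj_on_le (oneStickLaw θ) (Cross (ε N) (τ' N)) hAdj
    (ENNReal.ofReal (d N)) (ENNReal.ofReal (ρ N)) hd_enn ENNReal.ofReal_ne_top hρ_enn hsatN (N + 1) (f N) hfinv A
  -- assemble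
  calc stickLaw θ N (tubeSet σ N A (τ N))
      ≤ stickLaw θ N (tubeSet σ N A (τ' N)) := measure_mono (tubeSet_mono A (hτ'le N))
    _ = Measure.pi (fun _ : Fin (N + 1) => oneStickLaw θ)
          {Z : Cfg N | ∀ i ∈ A, ∀ j ∈ A, i ≠ j → ¬ Cross (ε N) (τ' N) (Z i) (Z j)} := by
        rw [stickLaw, withDensity_tensorPow_eq_pi θ hθ N, tubeSet_eq_setOf_not_cross]
    _ ≤ ∑ t ∈ Finset.range (f N + 1), ((k.choose t : ℕ) : ℝ≥0∞) * ENNReal.ofReal (ρ N) ^ (k - t) := hcont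
    _ = ENNReal.ofReal (∑ t ∈ Finset.range (f N + 1), (k.choose t : ℝ) * ρ N ^ (k - t)) :=
        sum_choose_ennreal_eq k (f N) (hρpos N).le
    _ ≤ ENNReal.ofReal (Real.exp (f N) * ((k : ℝ) / f N) ^ (f N) * ρ N ^ (k - f N)) :=
        ENNReal.ofReal_le_ofReal (Containers.sum_choose_mul_pow_le k (f N) (hf1 N) hfk (hρpos N).le (hρle1 N))
    _ ≤ ENNReal.ofReal (Real.exp (-(c * ((N + 1 : ℕ) : ℝ)))) :=
        ENNReal.ofReal_le_ofReal (hbN k hA hkN)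

end FewIdle

end

end Summit.AtomisticToContinuum.HydrodynamicLimit.Theorems.DiffuseBackwardInfluenceShare
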